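import Summits.CriticalPhenomena.Ising3DConformalLimit.Theses.PerfectScreening
import Literature.Probability.LatticeModels.HighDimPointwiseTriviality

/-!
# `CoulombImpliesNontrivial` (item stmt-CriticalPhenomena-13885): the statement is `d = 3`-specific

Negative/structural knowledge about the crux `…Theses.PerfectScreening.CoulombImpliesNontrivial`
(route PerfectScreening, r3), from its standing crux disprover (D-0016); THEOREM-ONLY, no new definitions.

`cruxAt_iff_noLimit_of_five_le`: the same statement on `ℤ^d`, `d ≥ 5` — Coulomb lower bound
`c/‖x‖^{d-2} ≤ ⟨σ₀σ_x⟩_{β_c(d)}` ⇒ every non-degenerate pointwise scaling limit has `U₄ ≢ 0` — holds IFF the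
Coulomb law excludes the existence of any non-degenerate pointwise limit: the tree theorem
`limitConnectedFour_eq_zero_of_hasPointwiseScalingLimit_holds` (Aizenman 1982 / Fröhlich 1982: tree diagram
bound + infrared bound) makes `U₄ ≡ 0` for every such limit. Since the Coulomb law HOLDS for `d ≥ 5`
(Duminil-Copin–Panis 2025, Thm 1.4; not yet a tree theorem, so it stays an antecedent here) and Gaussian
non-degenerate limits exist wherever `G ∼ A‖x‖^{2-d}` is known (spread-out `d > 4`, nearest-neighbour
`d ≫ 4`), the `d`-uniform strengthening of r3 is false: any proof at `d = 3` must spend `d < 4` (in the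
intended engine, the first-moment count `E N ≍ R^{4-d}` of common points of two sourced currents).
`cruxAt_three`: at `d = 3` the dimension-`d` form is r3 verbatim.
-/

noncomputable section

namespace Summit.CriticalPhenomena.Ising3DConformalLimit.CoulombImpliesNontrivialNegative

open Literature.Probability.LatticeModels Filter Set
open Summit.CriticalPhenomena.Ising3DConformalLimit.Theses
open scoped Topology

/-- At `d = 3` the dimension-`d` form of r3 (Coulomb law `c/‖x‖^{d-2} ≤ G`) is r3 verbatim. [folklore] -/
theorem cruxAt_three :
    ((∃ c : ℝ, 0 < c ∧ ∀ x : Site 3, x ≠ 0 → c / ‖x‖ ^ (3 - 2) ≤ criticalTwoPoint 3 x) →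
        ∀ (ρ : ℝ → ℝ) (S : CorrFamily 3), (∀ δ ∈ Set.Ioc (0:ℝ) 1, 0 < ρ δ) →
          HasPointwiseScalingLimit (criticalCorr 3) ρ S → IsNondegenerateTwoPoint S → HasNontrivialU4 S) ↔
      PerfectScreening.CoulombImpliesNontrivial := by
  have h : (∃ c : ℝ, 0 < c ∧ ∀ x : Site 3, x ≠ 0 → c / ‖x‖ ^ (3 - 2) ≤ criticalTwoPoint 3 x) ↔
      (∃ c : ℝ, 0 < c ∧ ∀ x : Site 3, x ≠ 0 → c / ‖x‖ ≤ criticalTwoPoint 3 x) := by simp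
  rw [h]
  exact Iff.rfl

/-- **`d ≥ 5`: the dimension-`d` form of r3 holds iff NO non-degenerate pointwise limit exists (granted the
Coulomb law there).** (`→`: a non-degenerate limit would have `U₄ ≢ 0` by the statement and `U₄ ≡ 0` by
`limitConnectedFour_eq_zero_of_hasPointwiseScalingLimit_holds`; `←`: vacuity.) [cite: AizenmanCMP1982, d > 4 Gaussianity of scaling limits and the tree diagram bound (as restated in CDM 2020, §8.1)] -/
theorem cruxAt_iff_noLimit_of_five_le {d : ℕ} (hd : 5 ≤ d) :
    ((∃ c : ℝ, 0 < c ∧ ∀ x : Site d, x ≠ 0 → c / ‖x‖ ^ (d - 2) ≤ criticalTwoPoint d x) →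
        ∀ (ρ : ℝ → ℝ) (S : CorrFamily d), (∀ δ ∈ Set.Ioc (0:ℝ) 1, 0 < ρ δ) →
          HasPointwiseScalingLimit (criticalCorr d) ρ S → IsNondegenerateTwoPoint S → HasNontrivialU4 S) ↔
      ((∃ c : ℝ, 0 < c ∧ ∀ x : Site d, x ≠ 0 → c / ‖x‖ ^ (d - 2) ≤ criticalTwoPoint d x) →
        ¬ ∃ (ρ : ℝ → ℝ) (S : CorrFamily d), (∀ δ ∈ Set.Ioc (0:ℝ) 1, 0 < ρ δ) ∧
          HasPointwiseScalingLimit (criticalCorr d) ρ S ∧ IsNondegenerateTwoPoint S) := by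
  constructor
  · rintro h hC ⟨ρ, S, hρ, hlim, hnd⟩
    obtain ⟨x, hx, hne⟩ := h hC ρ S hρ hlim hnd
    exact hne (limitConnectedFour_eq_zero_of_hasPointwiseScalingLimit_holds hd ρ S hρ hlim hnd x hx)
  · intro h hC ρ S hρ hlim hnd
    exact absurd ⟨ρ, S, hρ, hlim, hnd⟩ (h hC)

/-- **Corollary (`d ≥ 5`)**: the dimension-`d` form of r3 together with its (true) antecedent REFUTES the
existence of a non-degenerate pointwise limit — whereas at `d = 3` the route needs both. [folklore] -/
theorem no_limit_of_cruxAt_of_coulombAt {d : ℕ} (hd : 5 ≤ d)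
    (h : (∃ c : ℝ, 0 < c ∧ ∀ x : Site d, x ≠ 0 → c / ‖x‖ ^ (d - 2) ≤ criticalTwoPoint d x) →
        ∀ (ρ : ℝ → ℝ) (S : CorrFamily d), (∀ δ ∈ Set.Ioc (0:ℝ) 1, 0 < ρ δ) →
          HasPointwiseScalingLimit (criticalCorr d) ρ S → IsNondegenerateTwoPoint S → HasNontrivialU4 S)
    (hC : ∃ c : ℝ, 0 < c ∧ ∀ x : Site d, x ≠ 0 → c / ‖x‖ ^ (d - 2) ≤ criticalTwoPoint d x) :
    ¬ ∃ (ρ : ℝ → ℝ) (S : CorrFamily d), (∀ δ ∈ Set.Ioc (0:ℝ) 1, 0 < ρ δ) ∧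
      HasPointwiseScalingLimit (criticalCorr d) ρ S ∧ IsNondegenerateTwoPoint S :=
  (cruxAt_iff_noLimit_of_five_le hd).1 h hC

end Summit.CriticalPhenomena.Ising3DConformalLimit.CoulombImpliesNontrivialNegative

end
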